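import Literature.MathematicalPhysics.QuantumLattice.HubbardOpenBoxOccupationCode
import HarnessLib

/-!
# The open-cluster `t–t'` Hubbard Hamiltonian as an explicit integer-coded matrix (the dictionary)

Topic `MathematicalPhysics/QuantumLattice`, family `hubbard`. Part 2 of the occupation-code
dictionary (`HubbardOpenBoxOccupationCode`: `bitCount`, `orbRank`, `code`, the Jordan–Wigner sign as
a bit parity, entries of hopping words). Here: the integer-coded entry functions of the open `a × b`
cluster Hamiltonian `hubbardOpenBoxTT' a b t t' U` (`HubbardNNNHoppingOpenClusters`; LeBlanc et al.
2015 eq. (1) on an open cluster) and THE DICTIONARY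

`hubbardOpenBoxTT' a b t t' U s s' = -t·openBoxHopNN a b (code s) (code s')
   - t'·openBoxHopDiag a b (code s) (code s') + U·doccCode a b (code s) (code s')`

(`hubbardOpenBoxTT'_apply_eq_code`), with `hopCode p q m n` the coded hopping word `c†_p c_q` (bit tests
and the two Jordan–Wigner parities `bitCount`), `nnAdjCode` / `diagAdjCode` the row-major coded
adjacencies of the box (`= rectBoxGraph` / `rectBoxDiagGraph`, `nnAdjCode_siteRank`,
`diagAdjCode_siteRank`), `openBoxHop adj N` the coded hopping matrix of a coded adjacency, and
`doccCode` the coded double occupancy. All loops are structural (`sumNat`), so the kernel evaluates the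
entry functions by `decide` — this is the input of exact-diagonalisation certificates (kernel-checked
sector floors of small open clusters, consumed by the Anderson cluster bounds
`ClusterLowerBound.energyDensityTT'_ge_of_boxFloors_2x3`). Everything is proved; no named fact.

## References

* H. Q. Lin, J. E. Gubernatis, *Exact diagonalization methods for quantum systems*, Comput. Phys. 7
  (1993) 400, §II (integer-coded up/down occupations, fermion signs by bit counting).
  [cite: LinGubernatis1993, §II]
* J. P. F. LeBlanc et al., PRX 5 (2015) 041041, eq. (1) (the `t–t'` Hubbard model). [cite: LeBlancEtAl2015, eq. (1)]
* F. H. L. Essler et al., *The One-Dimensional Hubbard Model* (2005), §2.1. [cite: EsslerEtAl2005, §2.1]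
-/

namespace Literature.MathematicalPhysics.QuantumLattice

namespace OccupationCode

open Finset Matrix

/-! ### §1 Kernel-friendly loops and the coded entry functions -/

/-- `Σ_{i < n} f i` by structural recursion (kernel-friendly). [folklore] -/
def sumNat {α : Type*} [AddCommMonoid α] (f : ℕ → α) : ℕ → α
  | 0 => 0
  | n + 1 => sumNat f n + f n

/-- `sumNat f n = Σ_{i ∈ range n} f i` (the structural loop is the `Finset` sum; exact-arithmetic
certificate checking by evaluation). [cite: Neumaier2004CompleteSearch, §11] -/
theorem sumNat_eq {α : Type*} [AddCommMonoid α] (f : ℕ → α) : ∀ n, sumNat f n = ∑ i ∈ range n, f i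
  | 0 => by simp [sumNat]
  | n + 1 => by rw [sumNat, sumNat_eq f n, sum_range_succ]

/-- **Coded hopping word** `(c†_p c_q)` between the codes `m` (row) and `n` (column), orbital ranks
`p, q`: nonzero iff bit `q` of `n` is set, bit `p` of `n - 2^q` is clear and `m = n - 2^q + 2^p`; the value
is the product of the two Jordan–Wigner parities. [cite: LinGubernatis1993, §II] -/
def hopCode (p q m n : ℕ) : ℤ :=
  if n.testBit q = true ∧ (n - 2 ^ q).testBit p = false ∧ m = n - 2 ^ q + 2 ^ p then
    (-1) ^ (bitCount (n - 2 ^ q) p + bitCount (n - 2 ^ q) q) else 0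

/-- Nearest-neighbour adjacency of the sites of rank `P, Q` of the open `a × b` box (row-major ranks).
[cite: LeBlancEtAl2015, eq. (1)] -/
def nnAdjCode (b P Q : ℕ) : Bool :=
  decide ((P % b = Q % b ∧ lineAdj (P / b) (Q / b)) ∨
    (P / b = Q / b ∧ lineAdj (P % b) (Q % b)))

/-- Diagonal (next-nearest-neighbour) adjacency of the sites of rank `P, Q`. [cite: LeBlancEtAl2015, eq. (1)] -/
def diagAdjCode (b P Q : ℕ) : Bool :=
  decide (lineAdj (P / b) (Q / b) ∧ lineAdj (P % b) (Q % b))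

/-- Coded hopping matrix `Σ_{P, Q < N, adj P Q} Σ_σ (c†_{Pσ} c_{Qσ})` for a coded site adjacency `adj`
(entry between the codes `m`, `n`). [cite: LinGubernatis1993, §II] -/
def openBoxHop (adj : ℕ → ℕ → Bool) (N m n : ℕ) : ℤ :=
  sumNat (fun P => sumNat (fun Q => if adj P Q then
    sumNat (fun σ => hopCode (2 * P + σ) (2 * Q + σ) m n) 2 else 0) N) N

/-- Coded nearest-neighbour hopping matrix `Σ_{P ~ Q, σ} (c†_{Pσ} c_{Qσ})` of the open `a × b` box.
[cite: LinGubernatis1993, §II] -/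
def openBoxHopNN (a b m n : ℕ) : ℤ := openBoxHop (nnAdjCode b) (a * b) m n

/-- Coded diagonal hopping matrix `Σ_{P ~~ Q, σ} (c†_{Pσ} c_{Qσ})` of the open `a × b` box.
[cite: LinGubernatis1993, §II] -/
def openBoxHopDiag (a b m n : ℕ) : ℤ := openBoxHop (diagAdjCode b) (a * b) m n

/-- Casting a structural integer sum. [folklore] -/
private theorem cast_sumNat (f : ℕ → ℤ) : ∀ n : ℕ, ((sumNat f n : ℤ) : ℂ) = sumNat (fun i => (f i : ℂ)) n
  | 0 => by simp [sumNat]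
  | n + 1 => by rw [sumNat, sumNat, Int.cast_add, cast_sumNat f n]

/-- Coded double occupancy `[m = n] · #{P : bits 2P, 2P+1 of m set}`. [cite: LinGubernatis1993, §II] -/
def doccCode (a b m n : ℕ) : ℤ :=
  if m = n then sumNat (fun P => if m.testBit (2 * P) && m.testBit (2 * P + 1) then 1 else 0) (a * b) else 0

/-! ### §2 The dictionary -/

section Dictionary

variable {a b : ℕ}

/-- The rank of the orbital `(x, σ)` is `2·siteRank x + σ`. [cite: LinGubernatis1993, §II] -/
theorem orbRank_orb (x : Fin a ×ₗ Fin b) (σ : Fin 2) : orbRank (orb x σ) = 2 * siteRank x + (σ : ℕ) := rfl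

/-- **Coded hopping word = hopping word**: `(c†_i c_j) s s' = hopCode (orbRank i) (orbRank j) (code s) (code s')`.
[cite: LinGubernatis1993, §II] -/
theorem creation_mul_annihilation_apply_eq_hopCode (i j : Orb (Fin a ×ₗ Fin b))
    (s s' : Finset (Orb (Fin a ×ₗ Fin b))) :
    (creation i * annihilation j) s s' = (hopCode (orbRank i) (orbRank j) (code s) (code s') : ℂ) := by
  rw [creation_mul_annihilation_apply, hopCode]
  by_cases hj : j ∈ s'
  · have hq : (code s').testBit (orbRank j) = true := (mem_iff_testBit_code s' j).1 hj
    have hu : code (s'.erase j) = code s' - 2 ^ orbRank j := code_erase hj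
    by_cases hi : i ∉ s'.erase j
    · have hp : (code s' - 2 ^ orbRank j).testBit (orbRank i) = false := by
        rw [← hu]
        exact Bool.eq_false_iff.2 fun h => hi ((mem_iff_testBit_code _ i).2 h)
      by_cases hs : s = insert i (s'.erase j)
      · have hm : code s = code s' - 2 ^ orbRank j + 2 ^ orbRank i := by rw [hs, code_insert hi, hu]
        rw [if_pos ⟨hj, hi, hs⟩, if_pos ⟨hq, hp, hm⟩, jwSign_eq_neg_one_pow_bitCount,
          jwSign_eq_neg_one_pow_bitCount, hu, ← pow_add]
        push_cast
        ring
      · have hm : ¬ code s = code s' - 2 ^ orbRank j + 2 ^ orbRank i := by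
          intro h
          apply hs
          apply code_injective
          rw [h, code_insert hi, hu]
        rw [if_neg (fun h => hs h.2.2), if_neg (fun h => hm h.2.2)]
        simp
    · have hp : ¬ (code s' - 2 ^ orbRank j).testBit (orbRank i) = false := by
        rw [← hu, Bool.eq_false_iff, not_not]
        exact (mem_iff_testBit_code _ i).1 (not_not.1 hi)
      rw [if_neg (fun h => hi h.2.1), if_neg (fun h => hp h.2.1)]
      simp
  · have hq : ¬ (code s').testBit (orbRank j) = true := fun h => hj ((mem_iff_testBit_code s' j).2 h)
    rw [if_neg (fun h => hj h.1), if_neg (fun h => hq h.1)]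
    simp

/-- A sum over the sites of the box is the structural sum over their ranks (row-major enumeration).
[cite: LinGubernatis1993, §II] -/
theorem sum_site_eq_sumNat {α : Type*} [AddCommMonoid α] (f : ℕ → α) :
    ∑ x : Fin a ×ₗ Fin b, f (siteRank x) = sumNat f (a * b) := by
  rw [sumNat_eq, ← Fin.sum_univ_eq_sum_range]
  -- `siteRank` is a bijection onto `Fin (a * b)`
  let e : (Fin a ×ₗ Fin b) → Fin (a * b) := fun x => ⟨siteRank x, siteRank_lt_mul x⟩
  have he : Function.Bijective e := by
    refine (Fintype.bijective_iff_injective_and_card e).2 ⟨fun x y h => siteRank_injective ?_, ?_⟩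
    · exact congrArg Fin.val h
    · simp [Fintype.card_prod, Lex]
  exact Fintype.sum_bijective e he (fun x => f (siteRank x)) (fun k => f k) fun x => rfl

/-- Row-major rank arithmetic: `siteRank x / b = i`, `siteRank x % b = j` for `x = (i, j)`.
[cite: LinGubernatis1993, §II] -/
theorem siteRank_div_mod (x : Fin a ×ₗ Fin b) :
    siteRank x / b = ((ofLex x).1 : ℕ) ∧ siteRank x % b = ((ofLex x).2 : ℕ) := by
  have hb : 0 < b := lt_of_le_of_lt (Nat.zero_le _) (ofLex x).2.isLt
  have hj : ((ofLex x).2 : ℕ) < b := (ofLex x).2.isLt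
  unfold siteRank
  constructor
  · rw [Nat.mul_comm, Nat.mul_add_div hb, Nat.div_eq_of_lt hj, add_zero]
  · rw [Nat.mul_comm, Nat.mul_add_mod, Nat.mod_eq_of_lt hj]

/-- The coded nearest-neighbour adjacency is the box graph. [cite: LeBlancEtAl2015, eq. (1)] -/
theorem nnAdjCode_siteRank (x y : Fin a ×ₗ Fin b) :
    nnAdjCode b (siteRank x) (siteRank y) = true ↔ (rectBoxGraph a b).Adj x y := by
  obtain ⟨h1, h2⟩ := siteRank_div_mod x
  obtain ⟨h3, h4⟩ := siteRank_div_mod y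
  rw [nnAdjCode, decide_eq_true_iff, h1, h2, h3, h4]
  change _ ↔ ((ofLex x).2 = (ofLex y).2 ∧ _) ∨ ((ofLex x).1 = (ofLex y).1 ∧ _)
  rw [Fin.ext_iff, Fin.ext_iff]

/-- The coded diagonal adjacency is the diagonal box graph. [cite: LeBlancEtAl2015, eq. (1)] -/
theorem diagAdjCode_siteRank (x y : Fin a ×ₗ Fin b) :
    diagAdjCode b (siteRank x) (siteRank y) = true ↔ (rectBoxDiagGraph a b).Adj x y := by
  obtain ⟨h1, h2⟩ := siteRank_div_mod x
  obtain ⟨h3, h4⟩ := siteRank_div_mod y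
  rw [diagAdjCode, decide_eq_true_iff, h1, h2, h3, h4]
  rfl

/-- The hopping part of a graph Hamiltonian whose adjacency is coded by `adj`, in code form.
[cite: LinGubernatis1993, §II] -/
theorem sum_hop_eq_openBoxHop (G : SimpleGraph (Fin a ×ₗ Fin b)) [DecidableRel G.Adj] (adj : ℕ → ℕ → Bool)
    (hadj : ∀ x y, adj (siteRank x) (siteRank y) = true ↔ G.Adj x y) (s s' : Finset (Orb (Fin a ×ₗ Fin b))) :
    (∑ x : Fin a ×ₗ Fin b, ∑ y : Fin a ×ₗ Fin b, ∑ σ : Fin 2,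
        if G.Adj x y then (creation (orb x σ) * annihilation (orb y σ)) s s' else 0) =
      ((openBoxHop adj (a * b) (code s) (code s') : ℤ) : ℂ) := by
  simp only [openBoxHop, cast_sumNat, Int.cast_ite, Int.cast_zero]
  rw [← sum_site_eq_sumNat]
  refine Finset.sum_congr rfl fun x _ => ?_
  rw [← sum_site_eq_sumNat]
  refine Finset.sum_congr rfl fun y _ => ?_
  by_cases hxy : G.Adj x y
  · rw [if_pos ((hadj x y).2 hxy), Fin.sum_univ_two, if_pos hxy, if_pos hxy, sumNat, sumNat, sumNat,
      creation_mul_annihilation_apply_eq_hopCode, creation_mul_annihilation_apply_eq_hopCode,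
      orbRank_orb, orbRank_orb, orbRank_orb, orbRank_orb]
    simp
  · have : adj (siteRank x) (siteRank y) = false := Bool.eq_false_iff.2 fun h => hxy ((hadj x y).1 h)
    rw [this]
    simp [hxy]

/-- The coded double occupancy is the double occupancy. [cite: LinGubernatis1993, §II] -/
theorem sum_docc_eq_doccCode (s s' : Finset (Orb (Fin a ×ₗ Fin b))) :
    (∑ x : Fin a ×ₗ Fin b, (numberOp x 0 * numberOp x 1) s s') = (doccCode a b (code s) (code s') : ℂ) := by
  rw [doccCode]
  by_cases hss : s = s'
  · subst hss
    rw [if_pos rfl, show ((sumNat (fun P => if ((code s).testBit (2 * P) && (code s).testBit (2 * P + 1)) then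
        (1 : ℤ) else 0) (a * b) : ℤ) : ℂ) = sumNat (fun P => (((if ((code s).testBit (2 * P) &&
        (code s).testBit (2 * P + 1)) then (1 : ℤ) else 0) : ℤ) : ℂ)) (a * b) from by
          simp only [sumNat_eq]; push_cast; rfl,
      ← sum_site_eq_sumNat]
    refine Finset.sum_congr rfl fun x _ => ?_
    have h0 := mem_iff_testBit_code s (orb x 0)
    have h1 := mem_iff_testBit_code s (orb x 1)
    rw [orbRank_orb] at h0 h1
    rw [numberOp_mul_numberOp_apply, if_pos rfl]
    simp only [Fin.val_zero, add_zero, Fin.val_one] at h0 h1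
    by_cases hx0 : orb x 0 ∈ s
    · by_cases hx1 : orb x 1 ∈ s
      · rw [if_pos hx0, if_pos hx1, h0.1 hx0, h1.1 hx1]; simp
      · have : (code s).testBit (2 * siteRank x + 1) = false := Bool.eq_false_iff.2 fun h => hx1 (h1.2 h)
        rw [if_pos hx0, if_neg hx1, this]; simp
    · have : (code s).testBit (2 * siteRank x) = false := Bool.eq_false_iff.2 fun h => hx0 (h0.2 h)
      rw [if_neg hx0, this]; simp
  · have : code s ≠ code s' := fun h => hss (code_injective h)
    rw [if_neg this]
    simp only [numberOp_mul_numberOp_apply, if_neg hss, Finset.sum_const_zero, Int.cast_zero]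

/-- **THE DICTIONARY.** The entries of the open-cluster `t–t'` Hubbard Hamiltonian in the occupation
basis are the integer-coded functions of the codes of the two configurations:
`H^open_{a×b}(t,t',U) s s' = -t·openBoxHopNN a b (code s) (code s') - t'·openBoxHopDiag a b (code s) (code s')
+ U·doccCode a b (code s) (code s')`. [cite: LinGubernatis1993, §II] -/
theorem hubbardOpenBoxTT'_apply_eq_code (a b : ℕ) (t t' U : ℝ) (s s' : Finset (Orb (Fin a ×ₗ Fin b))) :
    hubbardOpenBoxTT' a b t t' U s s' =
      (((-t * openBoxHopNN a b (code s) (code s') - t' * openBoxHopDiag a b (code s) (code s') +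
        U * doccCode a b (code s) (code s') : ℝ)) : ℂ) := by
  rw [hubbardOpenBoxTT', Matrix.add_apply, hamiltonian_apply, hamiltonian_apply,
    sum_hop_eq_openBoxHop _ (nnAdjCode b) nnAdjCode_siteRank, sum_hop_eq_openBoxHop _ (diagAdjCode b) diagAdjCode_siteRank,
    sum_docc_eq_doccCode, openBoxHopNN, openBoxHopDiag]
  push_cast
  ring

end Dictionary

end OccupationCode

end Literature.MathematicalPhysics.QuantumLattice
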